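import Summits.QuantumAdvantage.QuantumAdvantage.Theorems.SosSandwichPseudoBoundedClosure
import Mathlib.RingTheory.Polynomial.Bernstein
import Mathlib.Analysis.Calculus.Deriv.Polynomial
import Mathlib.Analysis.Calculus.Deriv.MeanValue
import Mathlib.Analysis.Calculus.MeanValue

/-!
# SosSandwichCornerLift — part A (1/4): averages, the pointwise law `t(∏u) ≤ Σ t(u)`, the Bernstein lower-CDF detector

Tree twin of the cell node `decomp-qadv/lens-5/g20/CornerLift.lean` (§3–§5), Prop-free, importing landed
modules only (`SosSandwichPseudoBoundedClosure{A,}` = closure of `K_T = {PseudoBounded T}` under product /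
complement / Bernstein / rename, variance bookkeeping). The four parts A–D prove VARIANCE SATURATION inside `K`
(ledger item `stmt-QuantumAdvantage-27571`, support of the rank-2 crux `SosSandwich.PseudoBoundedAA`
stmt-QuantumAdvantage-15237) and the kernel equivalence of PB-AA with its top-variance-band slice (part D).

This part: uniform averages on finite types with one Fubini lemma for copy-structured cubes (`uavg_pi_prod`);
the corner functional `t(u) = u(1-u)` and `t(∏ uᵢ) ≤ Σ t(uᵢ)` on `[0,1]`; the univariate analysis of the
Bernstein lower CDF `cdf D k = Σ_{ν ≤ k} b_{D,ν}`: values in `[0,1]`, Chebyshev leakage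
`D r(1-r)/λ²` off the threshold (from Mathlib's `bernsteinPolynomial.variance`), Lipschitz constant `D`
(from `bernsteinPolynomial.derivative_succ` and the mean value inequality).
-/

set_option linter.dupNamespace false
set_option autoImplicit false

noncomputable section

open Finset
open Literature.Computability.QuantumComplexity
open Summit.QuantumAdvantage.QuantumAdvantage.Theorems.SosSandwich

namespace Summit.QuantumAdvantage.QuantumAdvantage.Theorems.SosSandwich.CornerLift

variable {N : ℕ}

/-! ## §3 Uniform averages on finite types; Fubini on copy-structured cubes -/

section UAvg

variable {Ω Ω' : Type*} [Fintype Ω] [Fintype Ω']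

/-- Uniform average of a real function over a finite type. [folklore] -/
def uavg (f : Ω → ℝ) : ℝ := (∑ ω, f ω) / (Fintype.card Ω : ℝ)

/-- `boolAvg` is the uniform average over the cube. [folklore] -/
theorem boolAvg_eq_uavg (f : (Fin N → Bool) → ℝ) : boolAvg f = uavg f := by
  unfold boolAvg uavg
  congr 1
  simp [Fintype.card_bool, Fintype.card_fin]

/-- Uniform averages are invariant under reindexing along an equivalence. [folklore] -/
theorem uavg_comp_equiv (e : Ω ≃ Ω') (f : Ω' → ℝ) : uavg (fun ω => f (e ω)) = uavg f := by
  unfold uavg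
  rw [Fintype.card_congr e]
  congr 1
  exact Fintype.sum_equiv e _ _ fun _ => rfl

/-- `uavg` is additive. [folklore] -/
theorem uavg_add (f g : Ω → ℝ) : uavg (fun ω => f ω + g ω) = uavg f + uavg g := by
  unfold uavg; rw [Finset.sum_add_distrib, add_div]

/-- `uavg` respects subtraction. [folklore] -/
theorem uavg_sub (f g : Ω → ℝ) : uavg (fun ω => f ω - g ω) = uavg f - uavg g := by
  unfold uavg; rw [Finset.sum_sub_distrib, sub_div]

/-- `uavg` commutes with scalar multiplication. [folklore] -/
theorem uavg_const_mul (a : ℝ) (f : Ω → ℝ) : uavg (fun ω => a * f ω) = a * uavg f := by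
  unfold uavg; rw [← Finset.mul_sum, mul_div_assoc]

/-- `uavg` commutes with finite sums. [folklore] -/
theorem uavg_sum {ι : Type*} (t : Finset ι) (F : ι → Ω → ℝ) :
    uavg (fun ω => ∑ i ∈ t, F i ω) = ∑ i ∈ t, uavg (F i) := by
  unfold uavg; rw [Finset.sum_comm, Finset.sum_div]

/-- The uniform average of a constant (nonempty type). [folklore] -/
theorem uavg_const [Nonempty Ω] (c : ℝ) : uavg (fun _ : Ω => c) = c := by
  unfold uavg
  rw [Finset.sum_const, Finset.card_univ, nsmul_eq_mul]
  have : (Fintype.card Ω : ℝ) ≠ 0 := Nat.cast_ne_zero.mpr Fintype.card_ne_zero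
  field_simp

/-- `uavg` is monotone. [folklore] -/
theorem uavg_mono {f g : Ω → ℝ} (h : ∀ ω, f ω ≤ g ω) : uavg f ≤ uavg g :=
  div_le_div_of_nonneg_right (Finset.sum_le_sum fun ω _ => h ω) (Nat.cast_nonneg _)

/-- `uavg` of a nonnegative function is nonnegative. [folklore] -/
theorem uavg_nonneg {f : Ω → ℝ} (h : ∀ ω, 0 ≤ f ω) : 0 ≤ uavg f :=
  div_nonneg (Finset.sum_nonneg fun ω _ => h ω) (Nat.cast_nonneg _)

/-- `uavg` of a function bounded above by a constant. [folklore] -/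
theorem uavg_le_const [Nonempty Ω] {f : Ω → ℝ} {c : ℝ} (h : ∀ ω, f ω ≤ c) : uavg f ≤ c := by
  have := uavg_mono (f := f) (g := fun _ => c) h
  rwa [uavg_const] at this

/-- `uavg` of a function bounded below by a constant. [folklore] -/
theorem const_le_uavg [Nonempty Ω] {f : Ω → ℝ} {c : ℝ} (h : ∀ ω, c ≤ f ω) : c ≤ uavg f := by
  have := uavg_mono (f := fun _ => c) (g := f) h
  rwa [uavg_const] at this

/-- **Fubini on a copy-structured cube**: the average of a product of functions of DISJOINT blocks of
coordinates is the product of the averages. [folklore] -/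
theorem uavg_pi_prod {C : Type*} [Fintype C] [DecidableEq C] (Φ : C → Ω → ℝ) :
    uavg (fun X : C → Ω => ∏ c, Φ c (X c)) = ∏ c, uavg (Φ c) := by
  unfold uavg
  rw [← Fintype.prod_sum (fun c ω => Φ c ω), Fintype.card_fun, Finset.prod_div_distrib,
    Finset.prod_const, Finset.card_univ]
  push_cast
  rfl

/-- Marginal of one block. [folklore] -/
theorem uavg_coord {C : Type*} [Fintype C] [DecidableEq C] [Nonempty Ω] (c₀ : C) (φ : Ω → ℝ) :
    uavg (fun X : C → Ω => φ (X c₀)) = uavg φ := by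
  have key := uavg_pi_prod (Ω := Ω) (fun c => if c = c₀ then φ else fun _ => (1 : ℝ))
  have lhs : (fun X : C → Ω => ∏ c, (if c = c₀ then φ else fun _ => (1 : ℝ)) (X c)) =
      fun X => φ (X c₀) := by
    funext X
    rw [Finset.prod_eq_single c₀ (fun c _ hc => by simp [hc]) (fun h => absurd (Finset.mem_univ c₀) h)]
    simp
  have rhs : (∏ c, uavg ((if c = c₀ then φ else fun _ => (1 : ℝ)))) = uavg φ := by
    rw [Finset.prod_eq_single c₀ (fun c _ hc => by simp [hc, uavg_const]) (fun h => absurd (Finset.mem_univ c₀) h)]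
    simp
  rw [lhs, rhs] at key
  exact key

end UAvg

/-! ## §4 Pointwise laws on `[0,1]`-valued products -/

section Pointwise

/-- `t(u) = u (1 - u)`, the distance-to-the-corner functional. [folklore] -/
def tcorner (u : ℝ) : ℝ := u * (1 - u)

/-- `t(1-u) = t(u)`. [folklore] -/
theorem tcorner_one_sub (u : ℝ) : tcorner (1 - u) = tcorner u := by unfold tcorner; ring

/-- `t(u) ≥ 0` on `[0,1]`. [folklore] -/
theorem tcorner_nonneg {u : ℝ} (h0 : 0 ≤ u) (h1 : u ≤ 1) : 0 ≤ tcorner u :=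
  mul_nonneg h0 (sub_nonneg.mpr h1)

/-- `t(u) ≤ 1/4`. [folklore] -/
theorem tcorner_le_quarter (u : ℝ) : tcorner u ≤ 1 / 4 := by
  unfold tcorner; nlinarith [sq_nonneg (u - 1 / 2)]

/-- `t(u) ≤ u` on `[0,1]`. [folklore] -/
theorem tcorner_le_self (u : ℝ) : tcorner u ≤ u := by
  unfold tcorner; nlinarith [sq_nonneg u]

/-- `t(u) ≤ 1-u` on `[0,1]`. [folklore] -/
theorem tcorner_le_one_sub (u : ℝ) : tcorner u ≤ 1 - u := by
  unfold tcorner; nlinarith [sq_nonneg (1 - u)]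

/-- Two-factor law: `t(ab) ≤ t(a) + t(b)` on `[0,1]²` (`ab(1-ab) = ab(1-a) + a²b(1-b)`). [folklore] -/
theorem tcorner_mul_le {a b : ℝ} (ha0 : 0 ≤ a) (ha1 : a ≤ 1) (hb0 : 0 ≤ b) (hb1 : b ≤ 1) :
    tcorner (a * b) ≤ tcorner a + tcorner b := by
  unfold tcorner
  nlinarith [mul_nonneg ha0 hb0, mul_nonneg (mul_nonneg ha0 hb0) (sub_nonneg.mpr ha1),
    mul_nonneg (mul_nonneg ha0 ha0) (mul_nonneg hb0 (sub_nonneg.mpr hb1)),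
    mul_nonneg ha0 (sub_nonneg.mpr ha1), mul_nonneg hb0 (sub_nonneg.mpr hb1),
    mul_le_mul_of_nonneg_right hb1 (mul_nonneg ha0 (sub_nonneg.mpr ha1))]

/-- A finite product of `[0,1]`-valued factors is `[0,1]`-valued. [folklore] -/
theorem prod_mem_unitInterval {ι : Type*} (t : Finset ι) {u : ι → ℝ}
    (h0 : ∀ i ∈ t, 0 ≤ u i) (h1 : ∀ i ∈ t, u i ≤ 1) :
    0 ≤ ∏ i ∈ t, u i ∧ ∏ i ∈ t, u i ≤ 1 :=
  ⟨Finset.prod_nonneg h0, Finset.prod_le_one h0 h1⟩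

/-- **Near-Booleanness is subadditive under AND**: `t(∏ uᵢ) ≤ Σ t(uᵢ)` for `uᵢ ∈ [0,1]`. [folklore] -/
theorem tcorner_prod_le {ι : Type*} (t : Finset ι) {u : ι → ℝ}
    (h0 : ∀ i ∈ t, 0 ≤ u i) (h1 : ∀ i ∈ t, u i ≤ 1) :
    tcorner (∏ i ∈ t, u i) ≤ ∑ i ∈ t, tcorner (u i) := by
  classical
  induction t using Finset.induction_on with
  | empty => simp [tcorner]
  | insert a t ha ih =>
    rw [Finset.prod_insert ha, Finset.sum_insert ha]
    have h0' : ∀ i ∈ t, 0 ≤ u i := fun i hi => h0 i (Finset.mem_insert_of_mem hi)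
    have h1' : ∀ i ∈ t, u i ≤ 1 := fun i hi => h1 i (Finset.mem_insert_of_mem hi)
    obtain ⟨hp0, hp1⟩ := prod_mem_unitInterval t h0' h1'
    exact (tcorner_mul_le (h0 a (Finset.mem_insert_self a t)) (h1 a (Finset.mem_insert_self a t))
      hp0 hp1).trans (by linarith [ih h0' h1'])

/-- One-coordinate Lipschitz law of AND: if two `[0,1]`-valued families agree off `i₀`, their products
differ by at most `|u i₀ - v i₀|`. [folklore] -/
theorem abs_prod_sub_prod_le {ι : Type*} [DecidableEq ι] (t : Finset ι) {u v : ι → ℝ} (i₀ : ι)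
    (hv0 : ∀ i ∈ t, 0 ≤ v i) (hv1 : ∀ i ∈ t, v i ≤ 1) (heq : ∀ i ∈ t, i ≠ i₀ → u i = v i) :
    |∏ i ∈ t, u i - ∏ i ∈ t, v i| ≤ |u i₀ - v i₀| := by
  by_cases hi : i₀ ∈ t
  · rw [← Finset.mul_prod_erase t u hi, ← Finset.mul_prod_erase t v hi]
    have hrest : ∏ i ∈ t.erase i₀, u i = ∏ i ∈ t.erase i₀, v i :=
      Finset.prod_congr rfl fun i hi' => heq i (Finset.mem_of_mem_erase hi') (Finset.ne_of_mem_erase hi')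
    rw [hrest, ← sub_mul, abs_mul]
    obtain ⟨hr0, hr1⟩ := prod_mem_unitInterval (t.erase i₀)
      (fun i hi' => hv0 i (Finset.mem_of_mem_erase hi')) (fun i hi' => hv1 i (Finset.mem_of_mem_erase hi'))
    rw [abs_of_nonneg hr0]
    exact mul_le_of_le_one_right (abs_nonneg _) hr1
  · have : ∏ i ∈ t, u i = ∏ i ∈ t, v i :=
      Finset.prod_congr rfl fun i hi' => heq i hi' (fun h => hi (h ▸ hi'))
    rw [this, sub_self, abs_zero]
    exact abs_nonneg _

end Pointwise

/-! ## §5 The Bernstein lower-CDF detector: univariate analysis on `[0,1]` -/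

section Detector

open Polynomial

/-- `cdfPoly D k = Σ_{ν ≤ k} b_{D,ν}`: the probability of at most `k` successes in `D` independent trials,
as a real polynomial in the success probability. [folklore] -/
def cdfPoly (D k : ℕ) : ℝ[X] := ∑ ν ∈ Finset.range (k + 1), bernsteinPolynomial ℝ D ν

/-- The detector function `r ↦ Pr[Bin(D, r) ≤ k]`. [folklore] -/
def cdf (D k : ℕ) (r : ℝ) : ℝ := (cdfPoly D k).eval r

/-- The Bernstein basis value `C(D,ν) r^ν (1-r)^{D-ν}`. [folklore] -/
def bterm (D ν : ℕ) (r : ℝ) : ℝ := (D.choose ν : ℝ) * r ^ ν * (1 - r) ^ (D - ν)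

/-- Evaluation of Mathlib's `bernsteinPolynomial ℝ D ν` at a real point. [folklore] -/
theorem eval_bernsteinPolynomial (D ν : ℕ) (r : ℝ) :
    (bernsteinPolynomial ℝ D ν).eval r = bterm D ν r := by
  simp [bernsteinPolynomial, bterm, Polynomial.eval_mul, Polynomial.eval_pow]

/-- `cdf D k r` as the sum of the Bernstein terms `ν ≤ k`. [folklore] -/
theorem cdf_eq_sum (D k : ℕ) (r : ℝ) : cdf D k r = ∑ ν ∈ Finset.range (k + 1), bterm D ν r := by
  unfold cdf cdfPoly
  rw [Polynomial.eval_finsetSum]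
  exact Finset.sum_congr rfl fun ν _ => eval_bernsteinPolynomial D ν r

/-- Bernstein terms are nonnegative on `[0,1]`. [folklore] -/
theorem bterm_nonneg (D ν : ℕ) {r : ℝ} (h0 : 0 ≤ r) (h1 : r ≤ 1) : 0 ≤ bterm D ν r := by
  unfold bterm
  have : 0 ≤ 1 - r := sub_nonneg.mpr h1
  positivity

/-- Bernstein terms with `ν > D` vanish. [folklore] -/
theorem bterm_eq_zero_of_lt {D ν : ℕ} (h : D < ν) (r : ℝ) : bterm D ν r = 0 := by
  simp [bterm, Nat.choose_eq_zero_of_lt h]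

/-- Binomial theorem: `Σ_{ν ≤ D} b_{D,ν}(r) = 1`. [folklore] -/
theorem sum_bterm (D : ℕ) (r : ℝ) : ∑ ν ∈ Finset.range (D + 1), bterm D ν r = 1 := by
  have h := add_pow r (1 - r) D
  rw [show r + (1 - r) = 1 by ring, one_pow] at h
  rw [h]
  exact Finset.sum_congr rfl fun ν _ => by unfold bterm; ring

/-- Each Bernstein term is at most `1` on `[0,1]`. [folklore] -/
theorem bterm_le_one (D ν : ℕ) {r : ℝ} (h0 : 0 ≤ r) (h1 : r ≤ 1) : bterm D ν r ≤ 1 := by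
  by_cases h : ν ≤ D
  · rw [← sum_bterm D r]
    exact Finset.single_le_sum (fun μ _ => bterm_nonneg D μ h0 h1)
      (Finset.mem_range.mpr (Nat.lt_succ_of_le h))
  · rw [bterm_eq_zero_of_lt (lt_of_not_ge h)]; exact zero_le_one

/-- The detector over the full range with an indicator: `cdf D k r = Σ_{ν ≤ D} [ν ≤ k] b_{D,ν}(r)`. -/
theorem cdf_eq_indicator_sum (D k : ℕ) (r : ℝ) :
    cdf D k r = ∑ ν ∈ Finset.range (D + 1), (if ν ≤ k then (1 : ℝ) else 0) * bterm D ν r := by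
  rw [cdf_eq_sum]
  have hR : ∑ ν ∈ Finset.range (D + 1), (if ν ≤ k then (1 : ℝ) else 0) * bterm D ν r =
      ∑ ν ∈ (Finset.range (D + 1)).filter (fun ν => ν ≤ k), bterm D ν r := by
    rw [Finset.sum_filter]
    exact Finset.sum_congr rfl fun ν _ => by split_ifs <;> simp
  rw [hR]
  have hS : (Finset.range (D + 1)).filter (fun ν => ν ≤ k) = (Finset.range (k + 1)).filter (fun ν => ν ≤ D) := by
    ext ν; simp [Finset.mem_filter, Finset.mem_range]; omega
  rw [hS, Finset.sum_filter]
  refine Finset.sum_congr rfl fun ν _ => ?_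
  split_ifs with h
  · rfl
  · exact bterm_eq_zero_of_lt (lt_of_not_ge h) r

/-- The upper tail `1 - cdf D k r` as the complementary Bernstein sum. [folklore] -/
theorem one_sub_cdf_eq (D k : ℕ) (r : ℝ) :
    1 - cdf D k r = ∑ ν ∈ Finset.range (D + 1), (if ν ≤ k then (0 : ℝ) else 1) * bterm D ν r := by
  rw [cdf_eq_indicator_sum, sub_eq_iff_eq_add, ← Finset.sum_add_distrib]
  conv_lhs => rw [← sum_bterm D r]
  exact Finset.sum_congr rfl fun ν _ => by split_ifs <;> ring

/-- `cdf D k r ≥ 0` on `[0,1]`. [folklore] -/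
theorem cdf_nonneg (D k : ℕ) {r : ℝ} (h0 : 0 ≤ r) (h1 : r ≤ 1) : 0 ≤ cdf D k r := by
  rw [cdf_eq_sum]; exact Finset.sum_nonneg fun ν _ => bterm_nonneg D ν h0 h1

/-- `cdf D k r ≤ 1` on `[0,1]`. [folklore] -/
theorem cdf_le_one (D k : ℕ) {r : ℝ} (h0 : 0 ≤ r) (h1 : r ≤ 1) : cdf D k r ≤ 1 := by
  have : 0 ≤ 1 - cdf D k r := by
    rw [one_sub_cdf_eq]
    exact Finset.sum_nonneg fun ν _ => mul_nonneg (by split_ifs <;> norm_num) (bterm_nonneg D ν h0 h1)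
  linarith

/-- The binomial variance identity, evaluated: `Σ_ν (D r - ν)² b_{D,ν}(r) = D r (1 - r)`
(Mathlib's `bernsteinPolynomial.variance`). [folklore] -/
theorem sum_sq_dev_bterm (D : ℕ) (r : ℝ) :
    ∑ ν ∈ Finset.range (D + 1), ((D : ℝ) * r - ν) ^ 2 * bterm D ν r = D * r * (1 - r) := by
  have h := congrArg (Polynomial.eval r) (bernsteinPolynomial.variance ℝ D)
  simp only [Polynomial.eval_finsetSum, Polynomial.eval_mul, Polynomial.eval_pow, Polynomial.eval_sub,
    Polynomial.eval_X, Polynomial.eval_natCast, Polynomial.eval_one, nsmul_eq_mul,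
    eval_bernsteinPolynomial] at h
  rw [← h]

/-- **Chebyshev, lower tail**: if every `ν ≤ k` is at least `lam` below the mean `D r`, then
`Pr[Bin(D,r) ≤ k] ≤ D r (1-r) / lam²`. [folklore] -/
theorem cdf_le_of_le (D k : ℕ) {r lam : ℝ} (h0 : 0 ≤ r) (h1 : r ≤ 1) (hlam : 0 < lam)
    (hk : (k : ℝ) ≤ D * r - lam) : cdf D k r ≤ D * r * (1 - r) / lam ^ 2 := by
  rw [le_div_iff₀ (pow_pos hlam 2), cdf_eq_indicator_sum, Finset.sum_mul, ← sum_sq_dev_bterm D r]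
  refine Finset.sum_le_sum fun ν hν => ?_
  split_ifs with hνk
  · rw [one_mul, mul_comm]
    refine mul_le_mul_of_nonneg_right ?_ (bterm_nonneg D ν h0 h1)
    have hν' : (ν : ℝ) ≤ k := Nat.cast_le.mpr hνk
    have : lam ≤ (D : ℝ) * r - ν := by linarith
    exact pow_le_pow_left₀ hlam.le this 2
  · rw [zero_mul, zero_mul]
    exact mul_nonneg (sq_nonneg _) (bterm_nonneg D ν h0 h1)

/-- **Chebyshev, upper tail**: if every `ν > k` is at least `lam` above the mean `D r`, then
`Pr[Bin(D,r) > k] ≤ D r (1-r) / lam²`. [folklore] -/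
theorem one_sub_cdf_le_of_le (D k : ℕ) {r lam : ℝ} (h0 : 0 ≤ r) (h1 : r ≤ 1) (hlam : 0 < lam)
    (hk : D * r + lam ≤ (k : ℝ) + 1) : 1 - cdf D k r ≤ D * r * (1 - r) / lam ^ 2 := by
  rw [le_div_iff₀ (pow_pos hlam 2), one_sub_cdf_eq, Finset.sum_mul, ← sum_sq_dev_bterm D r]
  refine Finset.sum_le_sum fun ν hν => ?_
  split_ifs with hνk
  · rw [zero_mul, zero_mul]
    exact mul_nonneg (sq_nonneg _) (bterm_nonneg D ν h0 h1)
  · rw [one_mul, mul_comm]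
    refine mul_le_mul_of_nonneg_right ?_ (bterm_nonneg D ν h0 h1)
    have hν' : (k : ℝ) + 1 ≤ ν := by exact_mod_cast Nat.succ_le_of_lt (lt_of_not_ge hνk)
    have : lam ≤ (ν : ℝ) - D * r := by linarith
    calc lam ^ 2 ≤ ((ν : ℝ) - D * r) ^ 2 := pow_le_pow_left₀ hlam.le this 2
      _ = ((D : ℝ) * r - ν) ^ 2 := by ring

/-- The telescoped derivative `(Σ_{ν ≤ k} b_{D,ν})' = -D · b_{D-1,k}`. [folklore] -/
theorem derivative_cdfPoly (D k : ℕ) :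
    Polynomial.derivative (cdfPoly D k) = -((D : ℝ[X]) * bernsteinPolynomial ℝ (D - 1) k) := by
  induction k with
  | zero =>
    simp only [cdfPoly, zero_add, Finset.range_one, Finset.sum_singleton, bernsteinPolynomial.derivative_zero]
    ring
  | succ k ih =>
    have e : cdfPoly D (k + 1) = cdfPoly D k + bernsteinPolynomial ℝ D (k + 1) := by
      unfold cdfPoly; rw [Finset.sum_range_succ]
    rw [e, Polynomial.derivative_add, ih, bernsteinPolynomial.derivative_succ]
    ring

/-- The derivative of `cdf D k` is `-D · b_{D-1,k}`. [folklore] -/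
theorem deriv_cdf (D k : ℕ) (t : ℝ) : deriv (cdf D k) t = -((D : ℝ) * bterm (D - 1) k t) := by
  have : cdf D k = fun x => (cdfPoly D k).eval x := rfl
  rw [this, Polynomial.deriv, derivative_cdfPoly]
  simp [Polynomial.eval_neg, Polynomial.eval_mul, eval_bernsteinPolynomial]

/-- `|cdf'| ≤ D` on `[0,1]`. [folklore] -/
theorem abs_deriv_cdf_le (D k : ℕ) {t : ℝ} (h0 : 0 ≤ t) (h1 : t ≤ 1) : |deriv (cdf D k) t| ≤ D := by
  rw [deriv_cdf, abs_neg, abs_of_nonneg (mul_nonneg (Nat.cast_nonneg _) (bterm_nonneg _ _ h0 h1))]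
  exact mul_le_of_le_one_right (Nat.cast_nonneg _) (bterm_le_one _ _ h0 h1)

/-- **The detector is `D`-Lipschitz on `[0,1]`** (mean value inequality). [folklore] -/
theorem cdf_lipschitz (D k : ℕ) {a b : ℝ} (ha0 : 0 ≤ a) (ha1 : a ≤ 1) (hb0 : 0 ≤ b) (hb1 : b ≤ 1) :
    |cdf D k a - cdf D k b| ≤ D * |a - b| := by
  have hdiff : ∀ x ∈ Set.Icc (0 : ℝ) 1, DifferentiableAt ℝ (cdf D k) x :=
    fun x _ => (cdfPoly D k).differentiableAt
  have hbound : ∀ x ∈ Set.Icc (0 : ℝ) 1, ‖deriv (cdf D k) x‖ ≤ D := fun x hx => by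
    rw [Real.norm_eq_abs]; exact abs_deriv_cdf_le D k hx.1 hx.2
  have h := Convex.norm_image_sub_le_of_norm_deriv_le hdiff hbound (convex_Icc 0 1) ⟨hb0, hb1⟩ ⟨ha0, ha1⟩
  simpa [Real.norm_eq_abs] using h

end Detector

end Summit.QuantumAdvantage.QuantumAdvantage.Theorems.SosSandwich.CornerLift

end
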